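import Summits.Schanuel.Schanuel.Theses.RootDecomp1HSigma
import Summits.Schanuel.Schanuel.Theorems.RootDecomp1HSigma

/-!
# RootDecomp1HSigmaItems — the three PROVED supports of the sibling route `RootDecomp1HSigma` (rev 0, born 2026-08-30T16:16:13Z)

T13c of lens-5 gen 13 «Σ» (critic VERDICT 2026-08-30T15:53:17Z OPTION S; writer-1 g7 WAKE 16:17:41Z): the route file
`Theses/RootDecomp1HSigma.lean` types the supports `StarLocalisationSigma` (stmt-Schanuel-26889), `BridgeSigmaGlue`
(stmt-Schanuel-26890) and `ConjStableReduction` (stmt-Schanuel-26891, = the CLOSED 1B item 24625 verbatim); their texts are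
`Iff.rfl`-transparent copies of the node constants proved in `Theorems/RootDecomp1HSigma.lean` (T13b, p778466) resp. of
`Theses.RootDecomp1B.ConjStableReduction` (closed by `RootDecomp1BConjStableReduction.conjStableReduction_holds`).
This file closes the three items BY NAME over the route decls. Sorry-free; standard axioms. Nothing here proves Schanuel; rung 0.
-/

set_option linter.dupNamespace false

namespace Summit.Schanuel.Schanuel.Theorems.RootDecomp1HSigma

/-- Route item stmt-Schanuel-26889 `StarLocalisationSigma` (σ-star-localisation under σ-stable lower ranks) — PROVED:
the node theorem `starLocalisationSigma_holds` read over the route decl (definitionally the same text). -/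
theorem starLocalisationSigma_item : Summit.Schanuel.Schanuel.Theses.RootDecomp1HSigma.StarLocalisationSigma :=
  starLocalisationSigma_holds

/-- Route item stmt-Schanuel-26890 `BridgeSigmaGlue` (the Σ-glue off the transverse residual) — PROVED: the node theorem
`bridgeSigmaGlue_holds` read over the route decls (definitionally the same texts). -/
theorem bridgeSigmaGlue_item : Summit.Schanuel.Schanuel.Theses.RootDecomp1HSigma.BridgeSigmaGlue :=
  bridgeSigmaGlue_holds

/-- Route item stmt-Schanuel-26891 `ConjStableReduction` (padding = 1B item 24625 verbatim) — PROVED by the landed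
`RootDecomp1BConjStableReduction.conjStableReduction_holds`. -/
theorem conjStableReduction_item : Summit.Schanuel.Schanuel.Theses.RootDecomp1HSigma.ConjStableReduction :=
  Summit.Schanuel.Schanuel.Theorems.RootDecomp1BConjStableReduction.conjStableReduction_holds

end Summit.Schanuel.Schanuel.Theorems.RootDecomp1HSigma
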